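import Literature.Topology.FourManifolds.HeightDictionary
import Literature.Topology.FourManifolds.MorseExistence
import Literature.Topology.FourManifolds.RegularLevelSet
import Literature.Topology.FourManifolds.ImmersionOrientation
import Mathlib.Analysis.Normed.Operator.NNNorm
import HarnessLib

/-!
# Generic directions for the boundary-adapted height function: nondegeneracy with a margin
(topic `Literature/Geometry/Riemannian`; third file of the discharge of the named fact
`Literature.Geometry.Riemannian.Sha1986_homotopyEquiv_cwComplex_of_pConvex` of
`PConvexDomainHomotopyType.lean` — Sha 1986, Thm. 1, flat case — after
`BoundaryAdaptedHessian.lean` (linear algebra of the Hessians `κ D²F + N DF ⊗ DF`) and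
`BoundaryAdaptedProfile.lean` (the profile `λ`); the road is described in the module docstring
of `BoundaryAdaptedHessian.lean`)

The critical points of the boundary-adapted height function `G = 1 + λ(-F) (⟪a, ·⟫ - c₁)` on
`Ω = {F ≤ 0} ⊂ ℝⁿ⁺¹` lie in a thin collar of `∂Ω = {F = 0}` at points `x` where `∇F(x)` is
antiparallel to `a` (horizontal points of the parallel hypersurfaces `{F = F(x)}`), and `G` is a
Morse function there as soon as `D²F(x)` is nondegenerate on `ker DF(x)` *with a margin*
independent of `x` (`nondegenerate_of_tangential_margin`).  This file supplies the margin: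

* `exists_tangential_margin` — a form nondegenerate on a hyperplane has a positive margin
  there (compactness of the unit sphere);
* `tangential_margin_of_near` — margins persist under small perturbations of the form and of
  the hyperplane;
* `exists_direction_forall_horizontal_separating` — **genericity** (Milnor 1963, §6, Thm. 6.6;
  Guillemin–Pollack, Ch. 1 §7): for a generic direction `a` the height `⟪a, ·⟫|∂Ω` is a Morse
  function, i.e. `D²F(y)|ker DF(y)` is nondegenerate at every horizontal boundary point — the
  tree's `ae_isMorse_height` (`MorseExistence.lean`) on the compact level manifold
  `RegularLevel` (`RegularLevelSet.lean`), read through the dictionary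
  `HeightDictionary.isMorse_inner_comp_iff` (`HeightDictionary.lean`);
* `exists_uniform_tangential_margin` — **uniform margin**: for such `a` there are `m₀, δ > 0`
  with margin `m₀` at every horizontal point of the collar `{-δ ≤ F ≤ 0}` (compactness of the
  horizontal boundary points and of `Ω`).

Everything is proved; no definitions, no named facts.

## References

* J. Milnor, *Morse theory*, Ann. of Math. Studies 51 (1963), §6, Thm. 6.6 (almost all
  distance/height functions are Morse). [Milnor1963]
* V. Guillemin, A. Pollack, *Differential topology* (1974; AMS Chelsea 2010), Ch. 1 §7.
  [GuilleminPollack2010]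
* J.-P. Sha, *`p`-convex Riemannian manifolds*, Invent. Math. 83 (1986), 437–447, Thm. 1.
  [Sha1986]
-/

noncomputable section

open scoped ContDiff Topology Manifold InnerProductSpace
open Set Filter MeasureTheory Function Module Metric

namespace Literature.Geometry.Riemannian

open Literature.Topology.FourManifolds

/-! ### Margins of tangential forms -/

section Margin

variable {U : Type*} [NormedAddCommGroup U] [InnerProductSpace ℝ U] [FiniteDimensional ℝ U]

/-- **Margin of a nondegenerate tangential form.**  If a continuous bilinear form `D` on a
finite-dimensional real inner product space is nondegenerate (left-separating) on the hyperplane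
`T = g^⊥`, then it has a positive margin there: some `m > 0` such that every `t ∈ T` has a
test vector `u ∈ T`, `‖u‖ ≤ 1`, with `m ‖t‖ ≤ |D(t, u)|` (the hypothesis of
`nondegenerate_of_tangential_margin`, `BoundaryAdaptedHessian.lean`).  Proof: `t ↦ D(t, ·)|T`
is an injective linear map on `T`; its norm has a positive minimum on the (compact) unit sphere
of `T`, and a functional of norm `> m` exceeds `m` on some vector of the unit ball
(`ContinuousLinearMap.exists_lt_apply_of_lt_opNorm`). [folklore] -/
theorem exists_tangential_margin (D : U →L[ℝ] U →L[ℝ] ℝ) (g : U)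
    (hsep : ∀ w, ⟪g, w⟫_ℝ = 0 → (∀ w', ⟪g, w'⟫_ℝ = 0 → D w w' = 0) → w = 0) :
    ∃ m > 0, ∀ t, ⟪g, t⟫_ℝ = 0 → ∃ u, ⟪g, u⟫_ℝ = 0 ∧ ‖u‖ ≤ 1 ∧ m * ‖t‖ ≤ |D t u| := by
  set T : Submodule ℝ U := (ℝ ∙ g)ᗮ with hT
  have hmemT : ∀ u, u ∈ T ↔ ⟪g, u⟫_ℝ = 0 := fun u =>
    Submodule.mem_orthogonal_singleton_iff_inner_right
  -- `t ↦ D(t, ·)|T`, a linear map `T → (T →L ℝ)`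
  let A : T →ₗ[ℝ] (T →L[ℝ] ℝ) :=
    { toFun := fun t => (D (t : U)).comp T.subtypeL
      map_add' := fun t t' => by ext u; simp
      map_smul' := fun c t => by ext u; simp }
  have hA_apply : ∀ (t u : T), A t u = D t u := fun t u => rfl
  have hAcont : Continuous A := LinearMap.continuous_of_finiteDimensional A
  have hΦ : Continuous fun t : T => ‖A t‖ := Continuous.norm (E := T →L[ℝ] ℝ) hAcont
  have hAinj : ∀ t : T, A t = 0 → t = 0 := by
    intro t ht
    have h1 : (t : U) = 0 := hsep t ((hmemT t).1 t.2) fun w' hw' => by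
      have := congrArg (fun L : T →L[ℝ] ℝ => L ⟨w', (hmemT w').2 hw'⟩) ht
      simpa [hA_apply] using this
    exact Subtype.ext h1
  -- the minimum of `‖A t‖` on the unit sphere of `T`
  set S : Set T := sphere (0 : T) 1 with hS
  have hScpt : IsCompact S := isCompact_sphere _ _
  by_cases hSne : S.Nonempty
  · obtain ⟨t₀, ht₀, hmin⟩ :=
      hScpt.exists_isMinOn hSne (hΦ.continuousOn)
    set m' : ℝ := ‖A t₀‖ with hm'
    have ht₀0 : t₀ ≠ 0 := by
      intro h; rw [h] at ht₀; simp [hS] at ht₀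
    have hm'pos : 0 < m' := by
      rw [hm']
      exact (norm_pos_iff (E := T →L[ℝ] ℝ)).mpr fun h => ht₀0 (hAinj t₀ h)
    refine ⟨m' / 2, by positivity, fun t ht => ?_⟩
    by_cases ht0 : t = 0
    · exact ⟨0, by simp, by simp, by simp [ht0]⟩
    have htn : 0 < ‖t‖ := norm_pos_iff.mpr ht0
    set tT : T := ⟨t, (hmemT t).2 ht⟩ with htT
    set t' : T := ‖t‖⁻¹ • tT with ht'
    have ht'S : t' ∈ S := by
      rw [hS, mem_sphere_zero_iff_norm, ht', norm_smul, norm_inv, norm_norm]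
      have : ‖tT‖ = ‖t‖ := rfl
      rw [this, inv_mul_cancel₀ htn.ne']
    have hle : m' ≤ ‖A t'‖ := hmin ht'S
    obtain ⟨u, hu1, hu⟩ := (A t').exists_lt_apply_of_lt_opNorm (half_lt_self hm'pos |>.trans_le hle)
    refine ⟨u, (hmemT u).1 u.2, by simpa using hu1.le, ?_⟩
    have h1 : A t' u = ‖t‖⁻¹ * D t u := by
      rw [hA_apply, ht']
      simp [htT]
    rw [h1, Real.norm_eq_abs, abs_mul, abs_inv, abs_norm] at hu
    rw [lt_inv_mul_iff₀ htn] at hu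
    linarith
  · -- `T = 0`: every tangential vector vanishes
    refine ⟨1, one_pos, fun t ht => ⟨0, by simp, by simp, ?_⟩⟩
    have : t = 0 := by
      by_contra h0
      apply hSne
      have htn : 0 < ‖t‖ := norm_pos_iff.mpr h0
      refine ⟨‖t‖⁻¹ • (⟨t, (hmemT t).2 ht⟩ : T), ?_⟩
      rw [hS, mem_sphere_zero_iff_norm, norm_smul, norm_inv, norm_norm]
      have : ‖(⟨t, (hmemT t).2 ht⟩ : T)‖ = ‖t‖ := rfl
      rw [this, inv_mul_cancel₀ htn.ne']
    simp [this]

omit [FiniteDimensional ℝ U] in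
/-- **Margins persist under perturbation.**  If `D` has margin `m` on `g^⊥` (`‖g‖ = 1`),
`‖D‖ ≤ M`, and `D'`, `g'` (`‖g'‖ = 1`) satisfy `‖D' - D‖ ≤ ε`, `‖g' - g‖ ≤ ε` with
`ε (m + 2M + 2) ≤ m/2`, then `D'` has margin `m/2` on `g'^⊥`: project `t ∈ g'^⊥` to
`t₀ ∈ g^⊥` (moving it by `≤ ε ‖t‖`), take the test vector `u₀` for `t₀`, project it to
`u ∈ g'^⊥` (moving it by `≤ ε`, not increasing its norm), and compare `D'(t, u)` with
`D(t₀, u₀)`.  Used to spread the margin from the (compact) set of horizontal boundary points to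
a neighbourhood (`exists_uniform_tangential_margin`). [folklore] -/
theorem tangential_margin_of_near (D D' : U →L[ℝ] U →L[ℝ] ℝ) {g g' : U} (hg : ‖g‖ = 1)
    (hg' : ‖g'‖ = 1) {m M ε : ℝ} (hm : 0 < m)
    (hmargin : ∀ t, ⟪g, t⟫_ℝ = 0 → ∃ u, ⟪g, u⟫_ℝ = 0 ∧ ‖u‖ ≤ 1 ∧ m * ‖t‖ ≤ |D t u|)
    (hM : ‖D‖ ≤ M) (hD : ‖D' - D‖ ≤ ε) (hgg : ‖g' - g‖ ≤ ε) (hε0 : 0 ≤ ε)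
    (hε : ε * (m + 2 * M + 2) ≤ m / 2) :
    ∀ t, ⟪g', t⟫_ℝ = 0 → ∃ u, ⟪g', u⟫_ℝ = 0 ∧ ‖u‖ ≤ 1 ∧ m / 2 * ‖t‖ ≤ |D' t u| := by
  intro t ht
  have hM0 : 0 ≤ M := (norm_nonneg D).trans hM
  -- project `t` to `g^⊥`
  obtain ⟨t₀, ht₀⟩ : ∃ t₀ : U, t₀ = t - ⟪g, t⟫_ℝ • g := ⟨_, rfl⟩
  have hgt₀ : ⟪g, t₀⟫_ℝ = 0 := by
    rw [ht₀, inner_sub_right, real_inner_smul_right, real_inner_self_eq_norm_sq, hg]; ring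
  have hgt : |⟪g, t⟫_ℝ| ≤ ε * ‖t‖ := by
    have h1 : ⟪g, t⟫_ℝ = ⟪g - g', t⟫_ℝ := by rw [inner_sub_left, ht, sub_zero]
    rw [h1]
    calc |⟪g - g', t⟫_ℝ| ≤ ‖g - g'‖ * ‖t‖ := abs_real_inner_le_norm _ _
      _ ≤ ε * ‖t‖ := by rw [norm_sub_rev]; gcongr
  have htt₀ : ‖t - t₀‖ ≤ ε * ‖t‖ := by
    have : t - t₀ = ⟪g, t⟫_ℝ • g := by rw [ht₀]; abel
    rw [this, norm_smul, hg, mul_one, Real.norm_eq_abs]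
    exact hgt
  have ht₀n : (1 - ε) * ‖t‖ ≤ ‖t₀‖ := by
    have h1 : ‖t‖ - ‖t - t₀‖ ≤ ‖t₀‖ := by
      have := norm_sub_norm_le t (t - t₀)
      rwa [sub_sub_cancel] at this
    nlinarith [norm_nonneg t]
  obtain ⟨u₀, hgu₀, hu₀1, hmar⟩ := hmargin t₀ hgt₀
  -- project the witness to `g'^⊥`
  obtain ⟨u, hu⟩ : ∃ u : U, u = u₀ - ⟪g', u₀⟫_ℝ • g' := ⟨_, rfl⟩
  have hg'u : ⟪g', u⟫_ℝ = 0 := by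
    rw [hu, inner_sub_right, real_inner_smul_right, real_inner_self_eq_norm_sq, hg']; ring
  have hg'u₀ : |⟪g', u₀⟫_ℝ| ≤ ε := by
    have h1 : ⟪g', u₀⟫_ℝ = ⟪g' - g, u₀⟫_ℝ := by rw [inner_sub_left, hgu₀, sub_zero]
    rw [h1]
    calc |⟪g' - g, u₀⟫_ℝ| ≤ ‖g' - g‖ * ‖u₀‖ := abs_real_inner_le_norm _ _
      _ ≤ ε * 1 := by gcongr
      _ = ε := mul_one ε
  have huu₀ : ‖u - u₀‖ ≤ ε := by
    have : u - u₀ = -(⟪g', u₀⟫_ℝ • g') := by rw [hu]; abel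
    rw [this, norm_neg, norm_smul, hg', mul_one, Real.norm_eq_abs]
    exact hg'u₀
  have hun : ‖u‖ ≤ 1 := by
    -- `u` is the orthogonal projection of `u₀` to `g'^⊥`: `‖u‖² = ‖u₀‖² - ⟪g', u₀⟫²`
    have h1 : ‖u‖ ^ 2 = ‖u₀‖ ^ 2 - ⟪g', u₀⟫_ℝ ^ 2 := by
      rw [hu, norm_sub_sq_real, norm_smul, real_inner_smul_right, real_inner_comm g' u₀, hg',
        mul_one, Real.norm_eq_abs, sq_abs]
      ring
    have h2 : ‖u‖ ^ 2 ≤ 1 := by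
      rw [h1]
      nlinarith [sq_nonneg ⟪g', u₀⟫_ℝ, norm_nonneg u₀]
    nlinarith [norm_nonneg u]
  refine ⟨u, hg'u, hun, ?_⟩
  -- compare `D' t u` with `D t₀ u₀`
  have hDn : ‖D‖ ≤ M := hM
  have hD'n : ‖D'‖ ≤ M + ε := by
    have := norm_le_insert' D' D   -- ‖D'‖ ≤ ‖D‖ + ‖D' - D‖
    linarith
  have e1 : |D' t u - D t u| ≤ ε * ‖t‖ := by
    have h1 : D' t u - D t u = (D' - D) t u := by simp
    rw [h1]
    calc |(D' - D) t u| = ‖(D' - D) t u‖ := (Real.norm_eq_abs _).symm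
      _ ≤ ‖(D' - D) t‖ * ‖u‖ := ContinuousLinearMap.le_opNorm _ _
      _ ≤ ‖D' - D‖ * ‖t‖ * ‖u‖ := by gcongr; exact ContinuousLinearMap.le_opNorm _ _
      _ ≤ ε * ‖t‖ * 1 := by gcongr
      _ = ε * ‖t‖ := mul_one _
  have e2 : |D t u - D t u₀| ≤ M * ‖t‖ * ε := by
    have h1 : D t u - D t u₀ = D t (u - u₀) := by simp
    rw [h1]
    calc |D t (u - u₀)| = ‖D t (u - u₀)‖ := (Real.norm_eq_abs _).symm
      _ ≤ ‖D t‖ * ‖u - u₀‖ := ContinuousLinearMap.le_opNorm _ _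
      _ ≤ ‖D‖ * ‖t‖ * ‖u - u₀‖ := by gcongr; exact ContinuousLinearMap.le_opNorm _ _
      _ ≤ M * ‖t‖ * ε := by gcongr
  have e3 : |D t u₀ - D t₀ u₀| ≤ M * (ε * ‖t‖) := by
    have h1 : D t u₀ - D t₀ u₀ = D (t - t₀) u₀ := by simp
    rw [h1]
    calc |D (t - t₀) u₀| = ‖D (t - t₀) u₀‖ := (Real.norm_eq_abs _).symm
      _ ≤ ‖D (t - t₀)‖ * ‖u₀‖ := ContinuousLinearMap.le_opNorm _ _
      _ ≤ ‖D‖ * ‖t - t₀‖ * ‖u₀‖ := by gcongr; exact ContinuousLinearMap.le_opNorm _ _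
      _ ≤ M * (ε * ‖t‖) * 1 := by gcongr
      _ = M * (ε * ‖t‖) := mul_one _
  have htri : |D t₀ u₀| ≤ |D' t u| + ε * ‖t‖ + M * ‖t‖ * ε + M * (ε * ‖t‖) := by
    have h3 := abs_sub_abs_le_abs_sub (D t₀ u₀) (D' t u)
    have h4 : |D' t u - D t₀ u₀| ≤ ε * ‖t‖ + M * ‖t‖ * ε + M * (ε * ‖t‖) := by
      have h5 : D' t u - D t₀ u₀ =
          (D' t u - D t u) + (D t u - D t u₀) + (D t u₀ - D t₀ u₀) := by ring
      rw [h5]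
      exact (abs_add_three _ _ _).trans (by linarith)
    rw [abs_sub_comm] at h4
    linarith
  have htn := norm_nonneg t
  nlinarith [hmar, ht₀n, htri, mul_nonneg hε0 htn, mul_nonneg hM0 htn]

end Margin

/-! ### Genericity: the height function of a generic direction is Morse on `∂Ω` -/

section Genericity

variable {n : ℕ}

/-- **A generic direction has only nondegenerate horizontal points** (Milnor 1963, §6,
Thm. 6.6 / Guillemin–Pollack, Ch. 1 §7, in the tree's form `ae_isMorse_height`: almost every
height function of a compact embedded manifold is a Morse function; read on the hypersurface
through the tree's dictionary `HeightDictionary.isMorse_inner_comp_iff`: the height `⟪a, ·⟫`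
is Morse on `{F = 0}` iff `D²F(y)|a^⊥` is nondegenerate at every horizontal point `y`,
`DF(y) = c ⟪a, ·⟫`).  For `F` smooth on `ℝⁿ⁺¹` with compact regular zero set there is a
direction `a ≠ 0` such that at every `y ∈ {F = 0}` with `DF(y) = c ⟪a, ·⟫` the form
`D²F(y)` is left-separating on `a^⊥ = ker DF(y)`.  (The level `{F = 0}` is the compact
manifold `Literature.Topology.FourManifolds.RegularLevel`; a null set does not exhaust `ℝⁿ⁺¹`,
nor does it together with `{0}`.) [cite: Milnor1963, §6 Thm. 6.6] -/
theorem exists_direction_forall_horizontal_separating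
    {F : EuclideanSpace ℝ (Fin (n + 1)) → ℝ} (hF : ContDiff ℝ ∞ F)
    (hK : IsCompact {x | F x = 0}) (hreg : ∀ x, F x = 0 → fderiv ℝ F x ≠ 0) :
    ∃ a : EuclideanSpace ℝ (Fin (n + 1)), a ≠ 0 ∧
      ∀ y, F y = 0 → ∀ c : ℝ, fderiv ℝ F y = c • innerSL ℝ a →
        ∀ w, ⟪a, w⟫_ℝ = 0 →
          (∀ w', ⟪a, w'⟫_ℝ = 0 → fderiv ℝ (fderiv ℝ F) y w w' = 0) → w = 0 := by
  -- the level `{F = 0}` as a compact smooth `n`-manifold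
  have hlev : IsRegularLevel (𝓡 (n + 1)) F 0 :=
    { contMDiff := hF.contMDiff
      isInteriorPoint := fun x _ => BoundarylessManifold.isInteriorPoint
      not_isMCriticalPt := fun x hx hc => hreg x hx (by
        rwa [IsMCriticalPt, mfderiv_eq_fderiv] at hc) }
  haveI : CompactSpace (RegularLevel hlev) := isCompact_iff_compactSpace.1 hK
  haveI : IsManifold (𝓡 n) 2 (RegularLevel hlev) := IsManifold.of_le (n := ∞) (by norm_cast)
  set e : RegularLevel hlev → EuclideanSpace ℝ (Fin (n + 1)) := RegularLevel.incl hlev with he_def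
  have he : ContMDiff (𝓡 n) (𝓡 (n + 1)) ∞ e := RegularLevel.contMDiff_incl hlev
  have hinj : ∀ y, Injective (mfderiv (𝓡 n) (𝓡 (n + 1)) e y) := fun y =>
    injective_mfderiv_of_isImmersionAt' ((RegularLevel.isImmersion_incl hlev).isImmersionAt y)
  -- almost every height function is Morse, and almost every vector is nonzero
  have hae := ae_isMorse_height he hinj
  have h0 : ∀ᵐ a ∂(volume : Measure (EuclideanSpace ℝ (Fin (n + 1)))), a ≠ 0 := by
    rw [ae_iff]
    have : {a : EuclideanSpace ℝ (Fin (n + 1)) | ¬a ≠ 0} = {0} := by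
      ext a; simp
    rw [this]
    exact measure_singleton 0
  haveI : (ae (volume : Measure (EuclideanSpace ℝ (Fin (n + 1))))).NeBot :=
    ae_neBot.2 (NeZero.ne volume)
  obtain ⟨a, hMorse, ha0⟩ := (hae.and h0).exists
  refine ⟨a, ha0, ?_⟩
  have hdim : finrank ℝ (EuclideanSpace ℝ (Fin (n + 1))) = n + 1 := finrank_euclideanSpace_fin
  have hF2 : ContDiff ℝ 2 F := hF.of_le (by norm_cast)
  have hFf : ∀ y : RegularLevel hlev, F (e y) = 0 := fun y => y.2
  have hDF0 : ∀ y : RegularLevel hlev, fderiv ℝ F (e y) ≠ 0 := fun y => hreg _ y.2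
  have key := (HeightDictionary.isMorse_inner_comp_iff (m := n) hdim he hinj hF2 hFf hDF0 ha0).1
    hMorse
  intro y hy c hc
  exact key ⟨y, hy⟩ c hc

end Genericity

/-! ### The uniform margin near the horizontal boundary points -/

section Uniform

variable {E : Type*} [NormedAddCommGroup E] [InnerProductSpace ℝ E] [FiniteDimensional ℝ E]

/-- **Uniform margin near the horizontal boundary points.**  Let `F` be smooth with compact
`Ω = {F ≤ 0}` and `DF ≠ 0` on `{F = 0}`, and let `a` be a direction all of whose horizontal
boundary points `y` (`F y = 0`, `DF(y) = c ⟪a, ·⟫`) have `D²F(y)|ker DF(y)` nondegenerate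
(`exists_direction_forall_horizontal_separating`).  Then there are `m₀ > 0` and `δ > 0` such
that at every horizontal point `x` of the collar `{-δ ≤ F ≤ 0}` the form `D²F(x)` has margin
`m₀` on `ker DF(x)`: for every `t` with `DF(x) t = 0` some `u` with `DF(x) u = 0`, `‖u‖ ≤ 1`
has `m₀ ‖t‖ ≤ |D²F(x)(t, u)|`.  Proof: each horizontal boundary point has a margin
(`exists_tangential_margin`), which persists on a neighbourhood (`tangential_margin_of_near`,
continuity of `x ↦ D²F(x)` and of the unit gradient); finitely many neighbourhoods cover the
compact set of horizontal boundary points, and the horizontal points of `Ω` outside their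
union form a compact set on which `F < 0`, hence `F ≤ -2δ`.  (These `x` are where the
critical points of the boundary-adapted height function lie; with the index bound and the
nondegeneracy criterion of `BoundaryAdaptedHessian.lean` this makes it a Morse function with
critical points of index `≤ p - 1`.) [folklore] -/
theorem exists_uniform_tangential_margin {F : E → ℝ} (hF : ContDiff ℝ ∞ F)
    (hK : IsCompact {x | F x ≤ 0})
    (hreg : ∀ x, F x = 0 → fderiv ℝ F x ≠ 0) {a : E}
    (hsep : ∀ y, F y = 0 → ∀ c : ℝ, fderiv ℝ F y = c • innerSL ℝ a →
      ∀ w, ⟪a, w⟫_ℝ = 0 → (∀ w', ⟪a, w'⟫_ℝ = 0 → fderiv ℝ (fderiv ℝ F) y w w' = 0) → w = 0) :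
    ∃ m₀ > 0, ∃ δ > 0, ∀ x, -δ ≤ F x → F x ≤ 0 → (∃ c : ℝ, fderiv ℝ F x = c • innerSL ℝ a) →
      ∀ t, fderiv ℝ F x t = 0 →
        ∃ u, fderiv ℝ F x u = 0 ∧ ‖u‖ ≤ 1 ∧ m₀ * ‖t‖ ≤ |fderiv ℝ (fderiv ℝ F) x t u| := by
  -- notation
  set D : E → E →L[ℝ] E →L[ℝ] ℝ := fun x => fderiv ℝ (fderiv ℝ F) x with hD
  set g : E → E := fun x => (InnerProductSpace.toDual ℝ E).symm (fderiv ℝ F x) with hg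
  have hg_inner : ∀ x w, ⟪g x, w⟫_ℝ = fderiv ℝ F x w := fun x w => by
    simp [hg, InnerProductSpace.toDual_symm_apply]
  set gh : E → E := fun x => ‖g x‖⁻¹ • g x with hgh
  have hgh_inner : ∀ x w, g x ≠ 0 → (⟪gh x, w⟫_ℝ = 0 ↔ fderiv ℝ F x w = 0) := fun x w hx => by
    rw [hgh, real_inner_smul_left, hg_inner, mul_eq_zero, inv_eq_zero, norm_eq_zero]
    exact or_iff_right hx
  have hgh_norm : ∀ x, g x ≠ 0 → ‖gh x‖ = 1 := fun x hx => by
    rw [hgh, norm_smul, norm_inv, norm_norm, inv_mul_cancel₀ (norm_ne_zero_iff.2 hx)]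
  -- continuity
  have hF1 : ContDiff ℝ ∞ (fderiv ℝ F) := hF.fderiv_right le_rfl
  have hDcont : Continuous D := hF1.continuous_fderiv (by simp)
  have hgcont : Continuous g := (InnerProductSpace.toDual ℝ E).symm.continuous.comp
    (hF.continuous_fderiv (by simp))
  -- the horizontal set and its closedness; compactness of `{F = 0}`
  set H : Set E := {x | ∃ c : ℝ, fderiv ℝ F x = c • innerSL ℝ a} with hH
  have hHclosed : IsClosed H := by
    have : H = (fderiv ℝ F) ⁻¹' ((ℝ ∙ (innerSL ℝ a : E →L[ℝ] ℝ) : Submodule ℝ (E →L[ℝ] ℝ)) : Set _) := by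
      ext x
      simp only [hH, mem_setOf_eq, mem_preimage, SetLike.mem_coe, Submodule.mem_span_singleton,
        eq_comm]
    rw [this]
    exact (Submodule.closed_of_finiteDimensional _).preimage (hF.continuous_fderiv (by simp))
  have hK0 : IsCompact {x | F x = 0} :=
    hK.of_isClosed_subset (isClosed_eq hF.continuous continuous_const) fun x hx => le_of_eq hx
  set Y : Set E := {x | F x = 0} ∩ H with hY
  have hYc : IsCompact Y := hK0.inter_right hHclosed
  -- per-point margin, spread to a neighbourhood
  have hloc : ∀ y ∈ Y, ∃ m > 0, ∃ V : Set E, IsOpen V ∧ y ∈ V ∧ ∀ x ∈ V, g x ≠ 0 ∧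
      ∀ t, fderiv ℝ F x t = 0 →
        ∃ u, fderiv ℝ F x u = 0 ∧ ‖u‖ ≤ 1 ∧ m * ‖t‖ ≤ |D x t u| := by
    rintro y ⟨hy0, c, hc⟩
    have hgy : g y ≠ 0 := by
      rw [hg]; simpa using hreg y hy0
    have hc0 : c ≠ 0 := by
      rintro rfl
      exact hreg y hy0 (by rw [hc, zero_smul])
    -- tangency at `y`: `⟪gh y, w⟫ = 0 ↔ ⟪a, w⟫ = 0`
    have htan : ∀ w, ⟪gh y, w⟫_ℝ = 0 ↔ ⟪a, w⟫_ℝ = 0 := fun w => by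
      rw [hgh_inner y w hgy, hc]
      simp [hc0]
    have hsep_y : ∀ w, ⟪gh y, w⟫_ℝ = 0 → (∀ w', ⟪gh y, w'⟫_ℝ = 0 → D y w w' = 0) → w = 0 :=
      fun w hw h => hsep y hy0 c hc w ((htan w).1 hw) fun w' hw' => h w' ((htan w').2 hw')
    obtain ⟨my, hmy, hmar⟩ := exists_tangential_margin (D y) (gh y) hsep_y
    set εy : ℝ := my / (2 * (my + 2 * ‖D y‖ + 2)) with hεy
    have hden : 0 < my + 2 * ‖D y‖ + 2 := by positivity
    have hεy0 : 0 < εy := by positivity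
    have hεy1 : εy * (my + 2 * ‖D y‖ + 2) ≤ my / 2 := by
      rw [hεy]; field_simp; rfl
    -- closeness of `D` and of the unit gradient near `y`
    have hghcont : ContinuousAt gh y := by
      have h1 : ContinuousAt (fun x => ‖g x‖⁻¹) y :=
        (continuous_norm.continuousAt.comp hgcont.continuousAt).inv₀ (norm_ne_zero_iff.2 hgy)
      exact h1.smul hgcont.continuousAt
    have hball : Metric.ball (D y) εy ∈ 𝓝 (D y) := Metric.ball_mem_nhds (D y) hεy0
    have hevD : ∀ᶠ x in 𝓝 y, D x ∈ Metric.ball (D y) εy :=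
      hDcont.continuousAt.preimage_mem_nhds hball
    have hevg : ∀ᶠ x in 𝓝 y, dist (gh x) (gh y) < εy :=
      (Metric.tendsto_nhds (u := gh) (a := gh y) (f := 𝓝 y)).1 hghcont εy hεy0
    have hev : ∀ᶠ x in 𝓝 y, g x ≠ 0 ∧ D x ∈ Metric.ball (D y) εy ∧ dist (gh x) (gh y) < εy :=
      (hgcont.continuousAt.eventually_ne hgy).and (hevD.and hevg)
    obtain ⟨V, hVP, hVopen, hyV⟩ := _root_.eventually_nhds_iff.1 hev
    refine ⟨my / 2, by positivity, V, hVopen, hyV, fun x hx => ?_⟩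
    obtain ⟨hgx, hDx', hghx⟩ := hVP x hx
    have hDx : ‖D x - D y‖ < εy := (mem_ball_iff_norm (a := D y) (b := D x) (r := εy)).1 hDx'
    refine ⟨hgx, fun t ht => ?_⟩
    rw [dist_eq_norm] at hghx
    have key := tangential_margin_of_near (D y) (D x) (hgh_norm y hgy) (hgh_norm x hgx) hmy hmar
      le_rfl hDx.le hghx.le hεy0.le hεy1 t ((hgh_inner x t hgx).2 ht)
    obtain ⟨u, hu, hu1, hle⟩ := key
    exact ⟨u, (hgh_inner x u hgx).1 hu, hu1, hle⟩
  choose! m hm V hVopen hyV hP using hloc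
  obtain ⟨s, hsY, hcover⟩ := hYc.elim_nhds_subcover V fun y hy => (hVopen y hy).mem_nhds (hyV y hy)
  set O : Set E := ⋃ y ∈ s, V y with hO
  have hOopen : IsOpen O := isOpen_biUnion fun y hy => hVopen y (hsY y hy)
  have hYO : Y ⊆ O := hcover
  -- localisation: horizontal points of `{-δ ≤ F ≤ 0}` lie in `O`
  have hδ : ∃ δ > 0, ∀ x, -δ ≤ F x → F x ≤ 0 → x ∈ H → x ∈ O := by
    set Z : Set E := {x | F x ≤ 0} ∩ (H ∩ Oᶜ) with hZ
    have hZc : IsCompact Z := hK.inter_right (hHclosed.inter hOopen.isClosed_compl)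
    rcases Z.eq_empty_or_nonempty with hZe | hZne
    · refine ⟨1, one_pos, fun x _ hx0 hxH => ?_⟩
      by_contra hxO
      have : x ∈ Z := ⟨hx0, hxH, hxO⟩
      rw [hZe] at this
      exact this
    · obtain ⟨x₀, hx₀Z, hmax⟩ := hZc.exists_isMaxOn hZne hF.continuous.continuousOn
      have hFx₀ : F x₀ < 0 := by
        refine lt_of_le_of_ne hx₀Z.1 fun h0 => hx₀Z.2.2 (hYO ⟨h0, hx₀Z.2.1⟩)
      refine ⟨-F x₀ / 2, by linarith, fun x hx hx0 hxH => ?_⟩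
      by_contra hxO
      have hxZ : x ∈ Z := ⟨hx0, hxH, hxO⟩
      have h' : F x ≤ F x₀ := isMaxOn_iff.1 hmax x hxZ
      linarith
  obtain ⟨δ, hδ0, hδO⟩ := hδ
  -- the uniform margin
  rcases s.eq_empty_or_nonempty with hs | hs
  · refine ⟨1, one_pos, δ, hδ0, fun x hx1 hx2 hxH => ?_⟩
    have hxO := hδO x hx1 hx2 hxH
    rw [hO, hs] at hxO
    simp at hxO
  · set m₀ : ℝ := s.inf' hs m with hm₀
    have hm₀pos : 0 < m₀ := by
      rw [hm₀, Finset.lt_inf'_iff]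
      exact fun y hy => hm y (hsY y hy)
    refine ⟨m₀, hm₀pos, δ, hδ0, fun x hx1 hx2 hxH t ht => ?_⟩
    have hxO := hδO x hx1 hx2 hxH
    rw [hO, mem_iUnion₂] at hxO
    obtain ⟨y, hys, hxV⟩ := hxO
    obtain ⟨u, hu, hu1, hle⟩ := (hP y (hsY y hys) x hxV).2 t ht
    refine ⟨u, hu, hu1, le_trans ?_ hle⟩
    have : m₀ ≤ m y := Finset.inf'_le m hys
    exact mul_le_mul_of_nonneg_right this (norm_nonneg t)

end Uniform

end Literature.Geometry.Riemannian
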